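import Literature.MathematicalPhysics.QuantumFieldTheory.Balaban1983to89.B13Contraction113

/-!
# `Balaban1983to89.B11Eq56Expansion` — T. Bałaban, *The variational problem and background fields in renormalization group method for lattice gauge theories*, Commun. Math. Phys. **102** (1985) 277–309 [Balaban1985Variational]: (56) p. 286 — the recursive solution of the linearizing fixed-point equation (49) to third order, «D^{(2)}(A′) = C^{(2)}(Lʲη A′), D^{(3)}(A′) = C^{(3)}(LʲηA′) − 2C^{(2)}(LʲηA′, LʲηHC^{(2)}(A′))», PROVED as the second- and third-order Taylor terms of ANY solution of (49) obeying (55), with explicit cubic and quartic remainder bounds (theorem-only module over the abstract complex normed spaces of `B13Contraction113`)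

statement-level skeleton of published theorems with citation tags; proofs where landed; nothing here is a claim about the Yang–Mills mass gap

PDF held: `paper:balaban1985-cmp102-variational-background` (journal page = PDF page + 276); p. 286 [PDF 10] from the text layer
`p0010.txt` and the render `run/shared/lean/pub/pub-balaban/b2b-balaban-ref1/pages/1985-cmp102-variational-background/…-p010-x2.png`
(lit-balaban reader/typer r08, gen 5, 2026-08-21).

CITATION HEADER (lean-in-tree rule 2026-08-18).  WHAT IS REPRODUCED: SKELETON row `B11.Eq55` (= displays (55)–(56) p. 286; HOME
`run/shared/lean/pub/lit-balaban/lit-balaban-r08/ROWS-B11.md`), its member **(56)** — so far represented only qualitatively («the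
expansion begins with second order terms» = `B11SchwarzRemainder.reading_begins_at_two`, and the order-2 coefficient read off a complex
slice by a Schwarz lemma, `reading_D3`): here the two PRINTED FORMULAS of (56) are proved to be the order-2 and order-3 terms of the
solution, with the orders of the remainders made quantitative.  Unit `lit-balaban-r08` (gen 5).  Sibling used BY NAME: `B13Contraction113`
(the abstract Sect. C scheme: `QuadAnalytic`, the fixed point of `X ↦ C(A′ − HX)` in the ball `‖X‖ ≤ 4C₂ε²` — `exists_unique_fixedPoint` —
and (55) = `bound_114`); nothing re-declared.

THE PRINT (p. 286 [PDF 10], verbatim up to OCR).  «From Eq. (49) we obtain |D(A′)| = |C_j(LʲηA′ − LʲηHD(A′))| ≦ C₂(Lʲη|A′| + B₀|D(A′)|)²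
≦ 4C₂|A′|²_{(−1)}. (55)  This implies that a power series expansion of D(A′) begins with second order terms. We can find this expression
from Eq. (49) and the expansion (136) [4] of the function C_j:  C_j(LʲηA′ − LʲηHD(A′)) = Σ_{n=2}^∞ C_j^{(n)}(LʲηA′ − LʲηH Σ_{m=2}^∞
D^{(m)}(A′)) = Σ_{n=2}^∞ D^{(n)}(A′), (56) where C^{(n)}, D^{(n)} are homogeneous polynomials of n-th order. From Eq. (56) a sequence of
recursive equations for D^{(n)} follows. It can be solved easily. For example we have on Λ_j  D^{(2)}(A′) = C^{(2)}(LʲηA′), D^{(3)}(A′) =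
C^{(3)}(LʲηA′) − 2C^{(2)}(LʲηA′, LʲηHC^{(2)}(A′)), and so on. Here C_j^{(2)}(A′, A″) denotes a symmetric bilinear form obtained by
polarization from the quadratic form C^{(2)}(A′), and C^{(2)}(A′) = C^{(2)}(LʲηA′) on Λ_j.»  [4] = T. Bałaban, *Averaging operations for
lattice gauge theories*, Commun. Math. Phys. **98** (1985) 17–51 [Balaban1985Averaging], (136) p. 39: «The function C_k can be decomposed
further into a sum of homogeneous polynomials, C_k(U₀, A) = C_k^{(2)}(U₀, A) + C_k^{(3)}(U₀, A) + … . (136)».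

DICTIONARY (the abstract Sect. C scheme of `B13Contraction113`, DIVERGENCE D-b13.14: the scale factors `Lʲη` are absorbed into the
norm `|·|_{(−1)}` of the configuration space).  `𝒴` ∋ `A′`, `Y` (configurations on Ω, norm `|·|_{(−1)}`), `𝒳` ∋ `X`, `D(A′)` (configurations
on 𝔅_k); `C : 𝒴 → 𝒳` = `C_j(Lʲη ·)`; `Hop : 𝒳 →ₗ[ℂ] 𝒴` = `H` with «|HB| ≦ B₀(Lʲη)⁻¹|B|» (46) as `‖Hop X‖ ≤ b‖X‖`; the fixed point `X` of
`X ↦ C(A′ − Hop X)` = `D(A′)` ((49)/(50)); (55) = `‖X‖ ≤ 4C₂‖A′‖²`.  The expansion (136) of [4] enters QUANTITATIVELY: a bilinear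
`C2 : 𝒴 →ₗ 𝒴 →ₗ 𝒳` (the polarization «C^{(2)}(A′, A″)», symmetric: `hsym`) and a trilinear `C3` with norm bounds `c₂`, `c₃`, and the two
Taylor remainders of `C` on the ball of radius `R`: `‖C(Y) − C2 Y Y‖ ≤ K₃‖Y‖³` and `‖C(Y) − C2 Y Y − C3 Y Y Y‖ ≤ K₄‖Y‖⁴` (what the Cauchy
estimates give for an analytic `C = Σ_{n≥2} C^{(n)}`, cf. `B11SchwarzRemainder`; HYPOTHESES here, nothing printed is asserted).  The printed
`D^{(2)}(A′) = C^{(2)}(LʲηA′)` is `C2 A′ A′`; the printed `D^{(3)}(A′)` is `D3 C2 C3 Hop A′ := C3 A′ A′ A′ − 2•C2 A′ (Hop (C2 A′ A′))`.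

WHAT THIS FILE PROVES (theorems only; constants explicit; `a := ‖A′‖`, smallness `4C₂·b·a ≤ 1` = the self-map condition of Sect. C at
the radius `a`, and `3a ≤ R` so that the argument `Y = A′ − Hop X`, `‖Y‖ ≤ 2a`, stays in the ball of the hypotheses).
* §1 algebra of the argument: `Y − A′ = −Hop X`, `‖Y − A′‖ ≤ 4bC₂a²`, `‖Y‖ ≤ 2a` (`norm_arg_sub_le`, `norm_arg_le`); bilinear/trilinear
  difference identities (`bilin_sub`, `trilin_sub`).
* §2 **(56), ORDER TWO**: `eq56_order2` — `‖X − C2 A′ A′‖ ≤ (8K₃ + 12c₂bC₂)·a³`: the solution agrees with `D^{(2)}(A′) = C^{(2)}(LʲηA′)` up to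
  third order (so «the expansion of D(A′) begins with second order terms» with the printed second-order term, and the CUBIC bound on
  `D₃ := D − D^{(2)}` that B13 p. 10 uses — cell GAPS G-adv2-29 (ii) — with an explicit constant).
* §3 **(56), ORDER THREE**: `eq56_order3` — `‖X − (C2 A′ A′ + D3)‖ ≤ K″·a⁴` with `D3 = C3 A′ A′ A′ − 2•C2 A′ (Hop (C2 A′ A′))` the PRINTED
  third-order term and `K″ = 16K₄ + 28c₃bC₂ + 16c₂b²C₂² + 2c₂b(8K₃ + 12c₂bC₂)`; the symmetry of the polarization is used exactly once
  (`C2 (Hop X) A′ = C2 A′ (Hop X)`), as in the printed factor `2`.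
* §4 the same two statements for THE fixed point produced by `B13Contraction113.exists_unique_fixedPoint` under its printed regime
  (`‖A′‖ < ε`, `9C₂bε < 1`, `3ε ≤ R`), (55) supplied by `bound_114` (`eq56_order2_fixedPoint`, `eq56_order3_fixedPoint`).

NOT PROVED HERE, NOT CLAIMED: the convergence of the full series Σ D^{(n)} (the «and so on»), the existence of the homogeneous expansion
(136) of [4] (hypotheses `h3`/`h4`), anything lattice-specific.  NOT summit progress.
-/

open Metric Set

namespace Literature.MathematicalPhysics.QuantumFieldTheory.Balaban1983to89.B11Eq56Expansion

open Literature.MathematicalPhysics.QuantumFieldTheory.Balaban1983to89.B13Contraction113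

variable {𝒳 𝒴 : Type*} [NormedAddCommGroup 𝒳] [NormedSpace ℂ 𝒳] [NormedAddCommGroup 𝒴] [NormedSpace ℂ 𝒴]

/-! ## §1  The argument `Y = A′ − HX` of (49) and the multilinear difference identities -/

section Argument

variable {Hop : 𝒳 →ₗ[ℂ] 𝒴} {b C₂ : ℝ} {A' : 𝒴} {X : 𝒳}

/-- `‖(A′ − HX) − A′‖ = ‖HX‖ ≤ b·4C₂‖A′‖²` under (46) `‖HX‖ ≤ b‖X‖` and (55) `‖X‖ ≤ 4C₂‖A′‖²`.
[cite: Balaban1985Variational, (55)-(56) p.286] -/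
theorem norm_arg_sub_le (hb : 0 ≤ b) (hHop : ∀ Z, ‖Hop Z‖ ≤ b * ‖Z‖) (hX : ‖X‖ ≤ 4 * C₂ * ‖A'‖ ^ 2) :
    ‖(A' - Hop X) - A'‖ ≤ 4 * b * C₂ * ‖A'‖ ^ 2 := by
  rw [sub_sub_cancel_left, norm_neg]
  exact (hHop X).trans ((mul_le_mul_of_nonneg_left hX hb).trans (le_of_eq (by ring)))

/-- `‖A′ − HX‖ ≤ 2‖A′‖` when moreover `4C₂b‖A′‖ ≤ 1` ((57): «|A| ≦ |A′| + B₀…4C₂|A′|² < 2ε₃»).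
[cite: Balaban1985Variational, (55)-(57) p.286] -/
theorem norm_arg_le (hb : 0 ≤ b) (hHop : ∀ Z, ‖Hop Z‖ ≤ b * ‖Z‖) (hX : ‖X‖ ≤ 4 * C₂ * ‖A'‖ ^ 2)
    (hsmall : 4 * C₂ * b * ‖A'‖ ≤ 1) : ‖A' - Hop X‖ ≤ 2 * ‖A'‖ := by
  have h1 : ‖A' - Hop X‖ ≤ ‖A'‖ + ‖(A' - Hop X) - A'‖ := by
    calc ‖A' - Hop X‖ = ‖A' + ((A' - Hop X) - A')‖ := by rw [add_sub_cancel]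
      _ ≤ ‖A'‖ + ‖(A' - Hop X) - A'‖ := norm_add_le _ _
  have h2 := norm_arg_sub_le hb hHop hX
  have h3 : 4 * b * C₂ * ‖A'‖ ^ 2 ≤ ‖A'‖ := by
    have := mul_le_mul_of_nonneg_right hsmall (norm_nonneg A')
    nlinarith
  linarith

end Argument

section Multilinear

variable (C2 : 𝒴 →ₗ[ℂ] 𝒴 →ₗ[ℂ] 𝒳) (C3 : 𝒴 →ₗ[ℂ] 𝒴 →ₗ[ℂ] 𝒴 →ₗ[ℂ] 𝒳)

/-- Bilinear difference: `C2 Y Y − C2 A A = C2 (Y − A) Y + C2 A (Y − A)`. [folklore]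
[cite: Balaban1985Variational, (56) p.286] -/
theorem bilin_sub (Y A : 𝒴) : C2 Y Y - C2 A A = C2 (Y - A) Y + C2 A (Y - A) := by
  simp only [map_sub, LinearMap.sub_apply]
  abel

/-- Trilinear difference: `C3 Y Y Y − C3 A A A = C3 (Y − A) Y Y + C3 A (Y − A) Y + C3 A A (Y − A)`. [folklore]
[cite: Balaban1985Variational, (56) p.286] -/
theorem trilin_sub (Y A : 𝒴) :
    C3 Y Y Y - C3 A A A = C3 (Y - A) Y Y + C3 A (Y - A) Y + C3 A A (Y - A) := by
  simp only [map_sub, LinearMap.sub_apply]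
  abel

/-- Bilinear expansion of the square of a difference with a SYMMETRIC form: `C2 (A − Z) (A − Z) = C2 A A − 2•C2 A Z + C2 Z Z` — the one
place where «symmetric bilinear form obtained by polarization» is used, producing the printed factor `2`.
[cite: Balaban1985Variational, (56) p.286] -/
theorem bilin_sub_sub (hsym : ∀ P Q : 𝒴, C2 P Q = C2 Q P) (A Z : 𝒴) :
    C2 (A - Z) (A - Z) = C2 A A - (2 : ℕ) • C2 A Z + C2 Z Z := by
  simp only [map_sub, LinearMap.sub_apply, hsym Z A, two_nsmul]
  abel

/-- The PRINTED third-order term of (56): `D^{(3)}(A′) = C^{(3)}(LʲηA′) − 2C^{(2)}(LʲηA′, LʲηHC^{(2)}(A′))` (scales absorbed).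
[cite: Balaban1985Variational, (56) p.286] -/
def D3 (Hop : 𝒳 →ₗ[ℂ] 𝒴) (A' : 𝒴) : 𝒳 := C3 A' A' A' - (2 : ℕ) • C2 A' (Hop (C2 A' A'))

/-- Unfolding `D3`. [cite: Balaban1985Variational, (56) p.286] -/
theorem D3_def (Hop : 𝒳 →ₗ[ℂ] 𝒴) (A' : 𝒴) :
    D3 C2 C3 Hop A' = C3 A' A' A' - (2 : ℕ) • C2 A' (Hop (C2 A' A')) := rfl

end Multilinear

/-! ## §2  (56), order two: `D(A′) = C^{(2)}(LʲηA′) + O(|A′|³)` -/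

section OrderTwo

variable {C : 𝒴 → 𝒳} (C2 : 𝒴 →ₗ[ℂ] 𝒴 →ₗ[ℂ] 𝒳) {Hop : 𝒳 →ₗ[ℂ] 𝒴} {b C₂ c₂ K₃ R : ℝ} {A' : 𝒴} {X : 𝒳}

/-- **(56), ORDER TWO — `D^{(2)}(A′) = C^{(2)}(LʲηA′)`**: for ANY solution `X` of (49) `X = C(A′ − HX)` obeying (55) `‖X‖ ≤ 4C₂‖A′‖²`, with
`‖HZ‖ ≤ b‖Z‖` (46), `‖C2 P Q‖ ≤ c₂‖P‖‖Q‖` and the second-order Taylor remainder `‖C(Y) − C2 Y Y‖ ≤ K₃‖Y‖³` of (136) [4] on `‖Y‖ < R`,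
in the regime `4C₂b‖A′‖ ≤ 1`, `3‖A′‖ ≤ R`:  `‖X − C2 A′ A′‖ ≤ (8K₃ + 12c₂bC₂)‖A′‖³` — the solution agrees with the printed second-order term to
third order, with an explicit cubic constant. [cite: Balaban1985Variational, (56) p.286] -/
theorem eq56_order2 (hb : 0 ≤ b) (hC₂ : 0 ≤ C₂) (hc₂ : 0 ≤ c₂) (hK₃ : 0 ≤ K₃)
    (hHop : ∀ Z, ‖Hop Z‖ ≤ b * ‖Z‖) (hC2 : ∀ P Q, ‖C2 P Q‖ ≤ c₂ * ‖P‖ * ‖Q‖)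
    (h3 : ∀ Y, ‖Y‖ < R → ‖C Y - C2 Y Y‖ ≤ K₃ * ‖Y‖ ^ 3)
    (hA : 0 < ‖A'‖) (hsmall : 4 * C₂ * b * ‖A'‖ ≤ 1) (hR : 3 * ‖A'‖ ≤ R)
    (hX : ‖X‖ ≤ 4 * C₂ * ‖A'‖ ^ 2) (hfix : C (A' - Hop X) = X) :
    ‖X - C2 A' A'‖ ≤ (8 * K₃ + 12 * c₂ * b * C₂) * ‖A'‖ ^ 3 := by
  set a := ‖A'‖ with ha
  set Y := A' - Hop X with hY
  have hYa : ‖Y‖ ≤ 2 * a := norm_arg_le hb hHop hX hsmall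
  have hYA : ‖Y - A'‖ ≤ 4 * b * C₂ * a ^ 2 := norm_arg_sub_le hb hHop hX
  have hYR : ‖Y‖ < R := by linarith
  -- X − C2 A′A′ = [C(Y) − C2 Y Y] + [C2 Y Y − C2 A′ A′]
  have e : X - C2 A' A' = (C Y - C2 Y Y) + (C2 (Y - A') Y + C2 A' (Y - A')) := by
    rw [← bilin_sub, ← hfix]; abel
  rw [e]
  have t1 : ‖C Y - C2 Y Y‖ ≤ 8 * K₃ * a ^ 3 := by
    calc ‖C Y - C2 Y Y‖ ≤ K₃ * ‖Y‖ ^ 3 := h3 Y hYR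
      _ ≤ K₃ * (2 * a) ^ 3 := by gcongr
      _ = 8 * K₃ * a ^ 3 := by ring
  have t2 : ‖C2 (Y - A') Y‖ ≤ c₂ * (4 * b * C₂ * a ^ 2) * (2 * a) := by
    calc ‖C2 (Y - A') Y‖ ≤ c₂ * ‖Y - A'‖ * ‖Y‖ := hC2 _ _
      _ ≤ c₂ * (4 * b * C₂ * a ^ 2) * (2 * a) := by gcongr
  have t3 : ‖C2 A' (Y - A')‖ ≤ c₂ * a * (4 * b * C₂ * a ^ 2) := by
    calc ‖C2 A' (Y - A')‖ ≤ c₂ * ‖A'‖ * ‖Y - A'‖ := hC2 _ _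
      _ ≤ c₂ * a * (4 * b * C₂ * a ^ 2) := by rw [← ha]; gcongr
  calc ‖(C Y - C2 Y Y) + (C2 (Y - A') Y + C2 A' (Y - A'))‖
      ≤ ‖C Y - C2 Y Y‖ + (‖C2 (Y - A') Y‖ + ‖C2 A' (Y - A')‖) :=
        norm_add_le_of_le le_rfl (norm_add_le _ _)
    _ ≤ 8 * K₃ * a ^ 3 + (c₂ * (4 * b * C₂ * a ^ 2) * (2 * a) + c₂ * a * (4 * b * C₂ * a ^ 2)) :=
        add_le_add t1 (add_le_add t2 t3)
    _ = (8 * K₃ + 12 * c₂ * b * C₂) * a ^ 3 := by ring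

end OrderTwo

/-! ## §3  (56), order three: `D(A′) = C^{(2)}(LʲηA′) + [C^{(3)}(LʲηA′) − 2C^{(2)}(LʲηA′, LʲηHC^{(2)}(A′))] + O(|A′|⁴)` -/

section OrderThree

variable {C : 𝒴 → 𝒳} (C2 : 𝒴 →ₗ[ℂ] 𝒴 →ₗ[ℂ] 𝒳) (C3 : 𝒴 →ₗ[ℂ] 𝒴 →ₗ[ℂ] 𝒴 →ₗ[ℂ] 𝒳) {Hop : 𝒳 →ₗ[ℂ] 𝒴}
variable {b C₂ c₂ c₃ K₃ K₄ R : ℝ} {A' : 𝒴} {X : 𝒳}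

/-- **(56), ORDER THREE — `D^{(3)}(A′) = C^{(3)}(LʲηA′) − 2C^{(2)}(LʲηA′, LʲηHC^{(2)}(A′))`**: for ANY solution `X` of (49) obeying (55),
with (46), the norm bounds `c₂`, `c₃` of the SYMMETRIC polarization `C2` and of `C3`, and both Taylor remainders of (136) [4] on `‖Y‖ < R`
(`‖C(Y) − C2 Y Y‖ ≤ K₃‖Y‖³`, `‖C(Y) − C2 Y Y − C3 Y Y Y‖ ≤ K₄‖Y‖⁴`), in the regime `4C₂b‖A′‖ ≤ 1`, `3‖A′‖ ≤ R`:
`‖X − (C2 A′ A′ + D3 C2 C3 Hop A′)‖ ≤ (16K₄ + 28c₃bC₂ + 16c₂b²C₂² + 2c₂b(8K₃ + 12c₂bC₂))‖A′‖⁴` — the solution agrees with the printed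
second- plus third-order terms to fourth order. [cite: Balaban1985Variational, (56) p.286] -/
theorem eq56_order3 (hsym : ∀ P Q : 𝒴, C2 P Q = C2 Q P) (hb : 0 ≤ b) (hC₂ : 0 ≤ C₂) (hc₂ : 0 ≤ c₂) (hc₃ : 0 ≤ c₃)
    (hK₃ : 0 ≤ K₃) (hK₄ : 0 ≤ K₄)
    (hHop : ∀ Z, ‖Hop Z‖ ≤ b * ‖Z‖) (hC2 : ∀ P Q, ‖C2 P Q‖ ≤ c₂ * ‖P‖ * ‖Q‖)
    (hC3 : ∀ P Q S, ‖C3 P Q S‖ ≤ c₃ * ‖P‖ * ‖Q‖ * ‖S‖)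
    (h3 : ∀ Y, ‖Y‖ < R → ‖C Y - C2 Y Y‖ ≤ K₃ * ‖Y‖ ^ 3)
    (h4 : ∀ Y, ‖Y‖ < R → ‖C Y - C2 Y Y - C3 Y Y Y‖ ≤ K₄ * ‖Y‖ ^ 4)
    (hA : 0 < ‖A'‖) (hsmall : 4 * C₂ * b * ‖A'‖ ≤ 1) (hR : 3 * ‖A'‖ ≤ R)
    (hX : ‖X‖ ≤ 4 * C₂ * ‖A'‖ ^ 2) (hfix : C (A' - Hop X) = X) :
    ‖X - (C2 A' A' + D3 C2 C3 Hop A')‖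
      ≤ (16 * K₄ + 28 * c₃ * b * C₂ + 16 * c₂ * b ^ 2 * C₂ ^ 2
          + 2 * c₂ * b * (8 * K₃ + 12 * c₂ * b * C₂)) * ‖A'‖ ^ 4 := by
  set a := ‖A'‖ with ha
  set Y := A' - Hop X with hY
  have hYa : ‖Y‖ ≤ 2 * a := norm_arg_le hb hHop hX hsmall
  have hYA : ‖Y - A'‖ ≤ 4 * b * C₂ * a ^ 2 := norm_arg_sub_le hb hHop hX
  have hYR : ‖Y‖ < R := by linarith
  have hHX : ‖Hop X‖ ≤ 4 * b * C₂ * a ^ 2 := by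
    have := norm_arg_sub_le (A' := A') hb hHop hX
    rwa [sub_sub_cancel_left, norm_neg] at this
  -- the second-order agreement, used for `Hop (X − C2 A′ A′)`
  have h2 : ‖X - C2 A' A'‖ ≤ (8 * K₃ + 12 * c₂ * b * C₂) * a ^ 3 :=
    eq56_order2 C2 hb hC₂ hc₂ hK₃ hHop hC2 h3 hA hsmall hR hX hfix
  -- algebra: X − (C2 A′A′ + D3) = R4(Y) + [C3 Y Y Y − C3 A′A′A′] + C2 (HX)(HX) − 2•C2 A′ (H(X − C2 A′ A′))
  have eC2 : C2 Y Y = C2 A' A' - (2 : ℕ) • C2 A' (Hop X) + C2 (Hop X) (Hop X) := by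
    rw [hY]; exact bilin_sub_sub C2 hsym A' (Hop X)
  have e : X - (C2 A' A' + D3 C2 C3 Hop A')
      = (C Y - C2 Y Y - C3 Y Y Y) + (C3 Y Y Y - C3 A' A' A') + C2 (Hop X) (Hop X)
          - (2 : ℕ) • C2 A' (Hop (X - C2 A' A')) := by
    rw [D3_def, eC2, hfix, map_sub Hop X (C2 A' A'), map_sub (C2 A') (Hop X) (Hop (C2 A' A')), smul_sub]
    abel
  rw [e]
  have t1 : ‖C Y - C2 Y Y - C3 Y Y Y‖ ≤ 16 * K₄ * a ^ 4 := by
    calc ‖C Y - C2 Y Y - C3 Y Y Y‖ ≤ K₄ * ‖Y‖ ^ 4 := h4 Y hYR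
      _ ≤ K₄ * (2 * a) ^ 4 := by gcongr
      _ = 16 * K₄ * a ^ 4 := by ring
  have t2 : ‖C3 Y Y Y - C3 A' A' A'‖ ≤ 28 * c₃ * b * C₂ * a ^ 4 := by
    rw [trilin_sub]
    have s1 : ‖C3 (Y - A') Y Y‖ ≤ c₃ * (4 * b * C₂ * a ^ 2) * (2 * a) * (2 * a) := by
      calc ‖C3 (Y - A') Y Y‖ ≤ c₃ * ‖Y - A'‖ * ‖Y‖ * ‖Y‖ := hC3 _ _ _
        _ ≤ c₃ * (4 * b * C₂ * a ^ 2) * (2 * a) * (2 * a) := by gcongr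
    have s2 : ‖C3 A' (Y - A') Y‖ ≤ c₃ * a * (4 * b * C₂ * a ^ 2) * (2 * a) := by
      calc ‖C3 A' (Y - A') Y‖ ≤ c₃ * ‖A'‖ * ‖Y - A'‖ * ‖Y‖ := hC3 _ _ _
        _ ≤ c₃ * a * (4 * b * C₂ * a ^ 2) * (2 * a) := by rw [← ha]; gcongr
    have s3 : ‖C3 A' A' (Y - A')‖ ≤ c₃ * a * a * (4 * b * C₂ * a ^ 2) := by
      calc ‖C3 A' A' (Y - A')‖ ≤ c₃ * ‖A'‖ * ‖A'‖ * ‖Y - A'‖ := hC3 _ _ _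
        _ ≤ c₃ * a * a * (4 * b * C₂ * a ^ 2) := by rw [← ha]; gcongr
    calc ‖C3 (Y - A') Y Y + C3 A' (Y - A') Y + C3 A' A' (Y - A')‖
        ≤ ‖C3 (Y - A') Y Y‖ + ‖C3 A' (Y - A') Y‖ + ‖C3 A' A' (Y - A')‖ := norm_add₃_le
      _ ≤ c₃ * (4 * b * C₂ * a ^ 2) * (2 * a) * (2 * a) + c₃ * a * (4 * b * C₂ * a ^ 2) * (2 * a)
            + c₃ * a * a * (4 * b * C₂ * a ^ 2) := add_le_add (add_le_add s1 s2) s3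
      _ = 28 * c₃ * b * C₂ * a ^ 4 := by ring
  have t3 : ‖C2 (Hop X) (Hop X)‖ ≤ 16 * c₂ * b ^ 2 * C₂ ^ 2 * a ^ 4 := by
    calc ‖C2 (Hop X) (Hop X)‖ ≤ c₂ * ‖Hop X‖ * ‖Hop X‖ := hC2 _ _
      _ ≤ c₂ * (4 * b * C₂ * a ^ 2) * (4 * b * C₂ * a ^ 2) := by gcongr
      _ = 16 * c₂ * b ^ 2 * C₂ ^ 2 * a ^ 4 := by ring
  have t4 : ‖(2 : ℕ) • C2 A' (Hop (X - C2 A' A'))‖ ≤ 2 * c₂ * b * (8 * K₃ + 12 * c₂ * b * C₂) * a ^ 4 := by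
    have s : ‖C2 A' (Hop (X - C2 A' A'))‖ ≤ c₂ * a * (b * ((8 * K₃ + 12 * c₂ * b * C₂) * a ^ 3)) := by
      calc ‖C2 A' (Hop (X - C2 A' A'))‖ ≤ c₂ * ‖A'‖ * ‖Hop (X - C2 A' A')‖ := hC2 _ _
        _ ≤ c₂ * a * (b * ‖X - C2 A' A'‖) := by rw [← ha]; gcongr; exact hHop _
        _ ≤ c₂ * a * (b * ((8 * K₃ + 12 * c₂ * b * C₂) * a ^ 3)) := by gcongr
    calc ‖(2 : ℕ) • C2 A' (Hop (X - C2 A' A'))‖ ≤ 2 * ‖C2 A' (Hop (X - C2 A' A'))‖ := by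
          rw [two_nsmul, two_mul]; exact norm_add_le _ _
      _ ≤ 2 * (c₂ * a * (b * ((8 * K₃ + 12 * c₂ * b * C₂) * a ^ 3))) := by gcongr
      _ = 2 * c₂ * b * (8 * K₃ + 12 * c₂ * b * C₂) * a ^ 4 := by ring
  calc ‖(C Y - C2 Y Y - C3 Y Y Y) + (C3 Y Y Y - C3 A' A' A') + C2 (Hop X) (Hop X)
          - (2 : ℕ) • C2 A' (Hop (X - C2 A' A'))‖
      ≤ ‖(C Y - C2 Y Y - C3 Y Y Y) + (C3 Y Y Y - C3 A' A' A') + C2 (Hop X) (Hop X)‖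
          + ‖(2 : ℕ) • C2 A' (Hop (X - C2 A' A'))‖ := norm_sub_le _ _
    _ ≤ (‖C Y - C2 Y Y - C3 Y Y Y‖ + ‖C3 Y Y Y - C3 A' A' A'‖ + ‖C2 (Hop X) (Hop X)‖)
          + ‖(2 : ℕ) • C2 A' (Hop (X - C2 A' A'))‖ := by gcongr; exact norm_add₃_le
    _ ≤ (16 * K₄ * a ^ 4 + 28 * c₃ * b * C₂ * a ^ 4 + 16 * c₂ * b ^ 2 * C₂ ^ 2 * a ^ 4)
          + 2 * c₂ * b * (8 * K₃ + 12 * c₂ * b * C₂) * a ^ 4 := add_le_add (add_le_add (add_le_add t1 t2) t3) t4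
    _ = (16 * K₄ + 28 * c₃ * b * C₂ + 16 * c₂ * b ^ 2 * C₂ ^ 2
          + 2 * c₂ * b * (8 * K₃ + 12 * c₂ * b * C₂)) * a ^ 4 := by ring

end OrderThree

/-! ## §4  For THE fixed point of Sect. C (`B13Contraction113.exists_unique_fixedPoint`), (55) supplied by `bound_114` -/

section FixedPoint

variable [CompleteSpace 𝒳]
variable {C : 𝒴 → 𝒳} (C2 : 𝒴 →ₗ[ℂ] 𝒴 →ₗ[ℂ] 𝒳) (C3 : 𝒴 →ₗ[ℂ] 𝒴 →ₗ[ℂ] 𝒴 →ₗ[ℂ] 𝒳) {Hop : 𝒳 →ₗ[ℂ] 𝒴}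
variable {b C₂ c₂ c₃ K₃ K₄ R ε : ℝ} {A' : 𝒴} {X : 𝒳}

/-- (56) order two for the fixed point of Sect. C in its printed regime: `C` quadratically bounded and line-analytic on `‖Y‖ < R`
(`QuadAnalytic C C₂ R`), `‖A′‖ < ε`, contraction `9C₂bε < 1`, `3ε ≤ R`, `X` the fixed point of `X ↦ C(A′ − HX)` in the ball `‖X‖ ≤ 4C₂ε²`
((55) is then `B13Contraction113.bound_114`): `‖X − C2 A′ A′‖ ≤ (8K₃ + 12c₂bC₂)‖A′‖³`. [cite: Balaban1985Variational, (56) p.286] -/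
theorem eq56_order2_fixedPoint (hC : QuadAnalytic C C₂ R) (hb : 0 ≤ b) (hC₂ : 0 ≤ C₂) (hc₂ : 0 ≤ c₂) (hK₃ : 0 ≤ K₃)
    (hHop : ∀ Z, ‖Hop Z‖ ≤ b * ‖Z‖) (hC2 : ∀ P Q, ‖C2 P Q‖ ≤ c₂ * ‖P‖ * ‖Q‖)
    (h3 : ∀ Y, ‖Y‖ < R → ‖C Y - C2 Y Y‖ ≤ K₃ * ‖Y‖ ^ 3)
    (hA : 0 < ‖A'‖) (hAε : ‖A'‖ < ε) (hq : 9 * C₂ * b * ε < 1) (hRC : 3 * ε ≤ R)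
    (hXball : X ∈ closedBall (0 : 𝒳) (4 * C₂ * ε ^ 2)) (hfix : C (A' - Hop X) = X) :
    ‖X - C2 A' A'‖ ≤ (8 * K₃ + 12 * c₂ * b * C₂) * ‖A'‖ ^ 3 := by
  have h55 : ‖X‖ ≤ 4 * C₂ * ‖A'‖ ^ 2 := bound_114 hC hC₂ hb hHop hAε hq hRC hXball hfix
  have hε : 0 < ε := hA.trans hAε
  have hsmall : 4 * C₂ * b * ‖A'‖ ≤ 1 := by
    have : 4 * C₂ * b * ‖A'‖ ≤ 4 * C₂ * b * ε :=
      mul_le_mul_of_nonneg_left hAε.le (by positivity)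
    nlinarith [mul_nonneg (mul_nonneg (by norm_num : (0:ℝ) ≤ 4) hC₂) hb]
  have hR : 3 * ‖A'‖ ≤ R := by linarith
  exact eq56_order2 C2 hb hC₂ hc₂ hK₃ hHop hC2 h3 hA hsmall hR h55 hfix

/-- (56) order three for the fixed point of Sect. C in its printed regime (as in `eq56_order2_fixedPoint`, plus the symmetric polarization,
the trilinear bound and the third-order Taylor remainder): `‖X − (C2 A′ A′ + D3 C2 C3 Hop A′)‖ ≤ K″‖A′‖⁴` with the explicit `K″` of
`eq56_order3`. [cite: Balaban1985Variational, (56) p.286] -/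
theorem eq56_order3_fixedPoint (hC : QuadAnalytic C C₂ R) (hsym : ∀ P Q : 𝒴, C2 P Q = C2 Q P) (hb : 0 ≤ b) (hC₂ : 0 ≤ C₂)
    (hc₂ : 0 ≤ c₂) (hc₃ : 0 ≤ c₃) (hK₃ : 0 ≤ K₃) (hK₄ : 0 ≤ K₄)
    (hHop : ∀ Z, ‖Hop Z‖ ≤ b * ‖Z‖) (hC2 : ∀ P Q, ‖C2 P Q‖ ≤ c₂ * ‖P‖ * ‖Q‖)
    (hC3 : ∀ P Q S, ‖C3 P Q S‖ ≤ c₃ * ‖P‖ * ‖Q‖ * ‖S‖)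
    (h3 : ∀ Y, ‖Y‖ < R → ‖C Y - C2 Y Y‖ ≤ K₃ * ‖Y‖ ^ 3)
    (h4 : ∀ Y, ‖Y‖ < R → ‖C Y - C2 Y Y - C3 Y Y Y‖ ≤ K₄ * ‖Y‖ ^ 4)
    (hA : 0 < ‖A'‖) (hAε : ‖A'‖ < ε) (hq : 9 * C₂ * b * ε < 1) (hRC : 3 * ε ≤ R)
    (hXball : X ∈ closedBall (0 : 𝒳) (4 * C₂ * ε ^ 2)) (hfix : C (A' - Hop X) = X) :
    ‖X - (C2 A' A' + D3 C2 C3 Hop A')‖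
      ≤ (16 * K₄ + 28 * c₃ * b * C₂ + 16 * c₂ * b ^ 2 * C₂ ^ 2
          + 2 * c₂ * b * (8 * K₃ + 12 * c₂ * b * C₂)) * ‖A'‖ ^ 4 := by
  have h55 : ‖X‖ ≤ 4 * C₂ * ‖A'‖ ^ 2 := bound_114 hC hC₂ hb hHop hAε hq hRC hXball hfix
  have hε : 0 < ε := hA.trans hAε
  have hsmall : 4 * C₂ * b * ‖A'‖ ≤ 1 := by
    have : 4 * C₂ * b * ‖A'‖ ≤ 4 * C₂ * b * ε :=
      mul_le_mul_of_nonneg_left hAε.le (by positivity)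
    nlinarith [mul_nonneg (mul_nonneg (by norm_num : (0:ℝ) ≤ 4) hC₂) hb]
  have hR : 3 * ‖A'‖ ≤ R := by linarith
  exact eq56_order3 C2 C3 hsym hb hC₂ hc₂ hc₃ hK₃ hK₄ hHop hC2 hC3 h3 h4 hA hsmall hR h55 hfix

end FixedPoint

end Literature.MathematicalPhysics.QuantumFieldTheory.Balaban1983to89.B11Eq56Expansion
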